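import Summits.NavierStokesRegularity.FluidComputer.PalasekTowerClayBridge
import Literature.Analysis.FluidPDE.LoopCirculation
import Literature.Analysis.FluidPDE.PineauVicolRSSProofs

/-!
# REGISTER v2.3′: kinematics of the cut-off solid rotation (the letter-witness field)

Cell `ns-blowup`, seat `ns-blowup-ecbridge-5` (g4); first half of the pair
`PalasekTowerRegisterGlobalLetterField.lean` (this file: the field and its readings, any amplitude,
any centre, any cut-off) / `PalasekTowerRegisterGlobalLetterWitness.lean` (the register reading:
the level-`m` LETTER of `ReadoutFloors` / `Letter S m v` is carried, inside the level-`m` CEILING, by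
a smooth divergence-free confined field of energy `≤ π N_m^{2β-5}`). LABEL: E–C typing (KINEMATICS
ONLY). WHAT THIS IS NOT: not Navier–Stokes evidence — no stage, flow, tower or blow-up is
constructed or asserted; the field is a time-slice, not a solution.

## Contents

* §1 the field `y ↦ (amp · χ(y)) • J(y - c)` with `J = rotGen` (the tree's rotation generator,
  `J z = (-z₁, z₀, 0)`) and the radial cut-off `χ(y) = smoothTransition (a - b ‖y - c‖²)`: smooth
  (`contDiff_field`), derivative `(amp χ) • J + κ ⟪y - c, ·⟫ ⊗ J(y - c)` (`hasFDerivAt_field`),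
  DIVERGENCE FREE (`isDivFree_field`: `tr J = 0` and `⟪z, J z⟫ = 0`, basis-free via Parseval), equal to
  the solid rotation `amp • J(y - c)` where `a - b‖y - c‖² ≥ 1` and to `0` where `≤ 0`, pointwise
  speed `≤ amp ‖y - c‖` (`‖J z‖ ≤ ‖z‖` is the tree's `PineauVicol2026.norm_rotGen_le`), gradient
  EXACTLY `amp • J` at the centre (so `‖Dv(c)‖ ≥ amp`), and
  circulation EXACTLY `2π amp ρ²` around the planar circle `circleLoop c ρ e₀ e₁` on which the
  cut-off is `1` (the circle stays at distance `|ρ|` from `c` with speed `2π|ρ|`);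
* §2 rate identities used by the reading: `A_m = N_m Y_m`, `A_m / N_m² = N_m^{β-2}`,
  `Y_m² / N_m³ = N_m^{2β-5}`, and `Σ_m N_m^{-γ} < ∞` for every `γ > 0` (super-lacunary scales).

References: A. J. Majda, A. L. Bertozzi, *Vorticity and Incompressible Flow* (CUP 2002) §1.2
(solid-body rotation `½ ω × y`), §1.6 (1.57) (circulation) [cite: MajdaBertozziCUP2002, §1.2];
S. Palasek, arXiv:2605.13827 §3.1 (dictionary `A_k = N_k^β`, `Y_k = N_k^{β-1}`)
[cite: Palasek2026ElementaryModel, §3.1].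
-/

noncomputable section

namespace Summit.NavierStokesRegularity.FluidComputer.PalasekTowerClayBridge

open Set MeasureTheory Filter Topology Function Real
open scoped ENNReal ContDiff NNReal InnerProductSpace RealInnerProductSpace
open Literature.Analysis.FluidPDE

namespace LetterWitness

/-! ## §1 The cut-off solid rotation `y ↦ (amp χ(y)) • J (y - c)` and its readings -/

/-- The radial cut-off `y ↦ smoothTransition (a - b ‖y - c‖²)` is smooth. [folklore] -/
theorem contDiff_cutoff (a b : ℝ) (c : EuclideanSpace ℝ (Fin 3)) {n : ℕ∞} :
    ContDiff ℝ n (fun y : EuclideanSpace ℝ (Fin 3) => Real.smoothTransition (a - b * ‖y - c‖ ^ 2)) :=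
  Real.smoothTransition.contDiff.comp
    (contDiff_const.sub (contDiff_const.mul ((contDiff_id.sub contDiff_const).norm_sq ℝ)))

/-- The radial cut-off has a RADIAL derivative: `D χ(y) = κ ⟪y - c, ·⟫` for some scalar `κ`.
[folklore] -/
theorem hasFDerivAt_cutoff (amp a b : ℝ) (c y : EuclideanSpace ℝ (Fin 3)) :
    ∃ κ : ℝ, HasFDerivAt (fun y : EuclideanSpace ℝ (Fin 3) => amp * Real.smoothTransition (a - b * ‖y - c‖ ^ 2))
      (κ • innerSL ℝ (y - c)) y := by
  have hd : Differentiable ℝ Real.smoothTransition :=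
    (Real.smoothTransition.contDiff (n := 1)).differentiable (by simp)
  have h1 := ((hasFDerivAt_id y).sub_const c).norm_sq
  have h2 := (h1.const_mul b).const_sub a
  have h3 := ((hd (a - b * ‖id y - c‖ ^ 2)).hasDerivAt.comp_hasFDerivAt y h2).const_mul amp
  refine ⟨amp * deriv Real.smoothTransition (a - b * ‖y - c‖ ^ 2) * (-(b * 2)), h3.congr_fderiv ?_⟩
  ext h
  simp [mul_comm, mul_assoc, mul_left_comm]

/-- The cut-off solid rotation is smooth. [folklore] -/
theorem contDiff_field (amp a b : ℝ) (c : EuclideanSpace ℝ (Fin 3)) {n : ℕ∞} :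
    ContDiff ℝ n (fun y : EuclideanSpace ℝ (Fin 3) =>
      (amp * Real.smoothTransition (a - b * ‖y - c‖ ^ 2)) • rotGen (y - c)) := by
  refine (contDiff_const.mul (contDiff_cutoff a b c)).smul ?_
  have h : ContDiff ℝ n (fun y : EuclideanSpace ℝ (Fin 3) => rotGenL (y - c)) :=
    rotGenL.contDiff.comp (contDiff_id.sub contDiff_const)
  simpa only [rotGenL_apply] using h

/-- The derivative of the cut-off solid rotation: `(amp χ(y)) • J + (κ ⟪y - c, ·⟫) ⊗ J(y - c)`.
[folklore] -/
theorem hasFDerivAt_field (amp a b : ℝ) (c y : EuclideanSpace ℝ (Fin 3)) :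
    ∃ κ : ℝ, HasFDerivAt (fun y : EuclideanSpace ℝ (Fin 3) =>
        (amp * Real.smoothTransition (a - b * ‖y - c‖ ^ 2)) • rotGen (y - c))
      ((amp * Real.smoothTransition (a - b * ‖y - c‖ ^ 2)) • rotGenL +
        (κ • innerSL ℝ (y - c)).smulRight (rotGen (y - c))) y := by
  obtain ⟨κ, hκ⟩ := hasFDerivAt_cutoff amp a b c y
  have hJ : HasFDerivAt (fun y : EuclideanSpace ℝ (Fin 3) => rotGen (y - c)) rotGenL y := by
    have h := (rotGenL.hasFDerivAt (x := y)).sub_const (rotGenL c)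
    have hfun : (fun z : EuclideanSpace ℝ (Fin 3) => rotGenL z - rotGenL c) =
        fun z => rotGen (z - c) := by
      funext z; rw [← map_sub]; rfl
    rw [hfun] at h
    exact h
  exact ⟨κ, hκ.smul hJ⟩

/-- **The cut-off solid rotation is divergence free**: `div ((amp χ) J(· - c)) = amp χ tr J +
κ ⟪y - c, J(y - c)⟫ = 0` (the generator is trace free and skew). [cite: MajdaBertozziCUP2002, §1.2] -/
theorem isDivFree_field (amp a b : ℝ) (c : EuclideanSpace ℝ (Fin 3)) :
    VectorCalculus.IsDivFree (fun y : EuclideanSpace ℝ (Fin 3) =>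
      (amp * Real.smoothTransition (a - b * ‖y - c‖ ^ 2)) • rotGen (y - c)) := by
  intro y
  obtain ⟨κ, hκ⟩ := hasFDerivAt_field amp a b c y
  set e := EuclideanSpace.basisFun (Fin 3) ℝ with he
  rw [divergence_eq_sum_inner_fderiv e, hκ.fderiv]
  have hterm : ∀ i, ⟪e i, ((amp * Real.smoothTransition (a - b * ‖y - c‖ ^ 2)) • rotGenL +
      (κ • innerSL ℝ (y - c)).smulRight (rotGen (y - c))) (e i)⟫ =
        κ * (⟪y - c, e i⟫ * ⟪e i, rotGen (y - c)⟫) := by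
    intro i
    have h1 : ((amp * Real.smoothTransition (a - b * ‖y - c‖ ^ 2)) • rotGenL +
        (κ • innerSL ℝ (y - c)).smulRight (rotGen (y - c))) (e i) =
        (amp * Real.smoothTransition (a - b * ‖y - c‖ ^ 2)) • rotGen (e i) +
          (κ * ⟪y - c, e i⟫) • rotGen (y - c) := by
      simp [innerSL_apply_apply, inner_sub_left]
    have h2 : ⟪e i, rotGen (e i)⟫ = 0 := by rw [real_inner_comm]; exact inner_rotGen_self _
    rw [h1, inner_add_right, real_inner_smul_right, real_inner_smul_right, h2, mul_zero, zero_add,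
      mul_assoc]
  simp_rw [hterm]
  rw [← Finset.mul_sum, e.sum_inner_mul_inner, real_inner_comm, inner_rotGen_self, mul_zero]

/-- Where the cut-off argument is `≥ 1` the field IS the solid rotation `amp J(y - c)`. [folklore] -/
theorem field_apply_of_one_le {amp a b : ℝ} {c y : EuclideanSpace ℝ (Fin 3)}
    (h : 1 ≤ a - b * ‖y - c‖ ^ 2) :
    (amp * Real.smoothTransition (a - b * ‖y - c‖ ^ 2)) • rotGen (y - c) = amp • rotGen (y - c) := by
  rw [Real.smoothTransition.one_of_one_le h, mul_one]

/-- Where the cut-off argument is `≤ 0` the field vanishes. [folklore] -/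
theorem field_apply_of_nonpos {amp a b : ℝ} {c y : EuclideanSpace ℝ (Fin 3)}
    (h : a - b * ‖y - c‖ ^ 2 ≤ 0) :
    (amp * Real.smoothTransition (a - b * ‖y - c‖ ^ 2)) • rotGen (y - c) = 0 := by
  rw [Real.smoothTransition.zero_of_nonpos h, mul_zero, zero_smul]

/-- Pointwise speed bound `‖(amp χ) J(y - c)‖ ≤ amp ‖y - c‖` (`0 ≤ χ ≤ 1`, `‖J z‖ ≤ ‖z‖`). [folklore] -/
theorem norm_field_le {amp : ℝ} (hamp : 0 ≤ amp) (a b : ℝ) (c y : EuclideanSpace ℝ (Fin 3)) :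
    ‖(amp * Real.smoothTransition (a - b * ‖y - c‖ ^ 2)) • rotGen (y - c)‖ ≤ amp * ‖y - c‖ := by
  rw [norm_smul, Real.norm_eq_abs,
    abs_of_nonneg (mul_nonneg hamp (Real.smoothTransition.nonneg _))]
  have h1 : amp * Real.smoothTransition (a - b * ‖y - c‖ ^ 2) ≤ amp :=
    mul_le_of_le_one_right hamp (Real.smoothTransition.le_one _)
  exact mul_le_mul h1 (PineauVicol2026.norm_rotGen_le _) (norm_nonneg _) hamp

/-- **The gradient at the centre is `amp J`** (for `a ≥ 1`: the cut-off is `1` at the centre and its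
derivative is radial, hence zero there). [folklore] -/
theorem hasFDerivAt_field_centre {amp a : ℝ} (ha : 1 ≤ a) (b : ℝ) (c : EuclideanSpace ℝ (Fin 3)) :
    HasFDerivAt (fun y : EuclideanSpace ℝ (Fin 3) =>
        (amp * Real.smoothTransition (a - b * ‖y - c‖ ^ 2)) • rotGen (y - c)) (amp • rotGenL) c := by
  obtain ⟨κ, hκ⟩ := hasFDerivAt_field amp a b c c
  refine hκ.congr_fderiv ?_
  have h0 : rotGen (c - c) = 0 := by rw [sub_self, ← rotGenL_apply, map_zero]
  have h1 : Real.smoothTransition (a - b * ‖c - c‖ ^ 2) = 1 := by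
    apply Real.smoothTransition.one_of_one_le
    simpa using ha
  rw [h0, h1, mul_one]
  ext h
  simp

/-- **Strain reading at the centre**: `‖D v(c)‖ ≥ amp` (test the gradient `amp J` on `e₀`, `J e₀ = e₁`).
[folklore] -/
theorem le_norm_fderiv_field_centre {amp a : ℝ} (hamp : 0 ≤ amp) (ha : 1 ≤ a) (b : ℝ)
    (c : EuclideanSpace ℝ (Fin 3)) :
    amp ≤ ‖fderiv ℝ (fun y : EuclideanSpace ℝ (Fin 3) =>
        (amp * Real.smoothTransition (a - b * ‖y - c‖ ^ 2)) • rotGen (y - c)) c‖ := by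
  rw [(hasFDerivAt_field_centre ha b c (amp := amp)).fderiv]
  have h := (amp • rotGenL).le_opNorm (EuclideanSpace.single (0 : Fin 3) (1 : ℝ))
  have h1 : ‖(amp • rotGenL) (EuclideanSpace.single (0 : Fin 3) (1 : ℝ))‖ = amp := by
    have h3 : (amp • rotGenL) (EuclideanSpace.single (0 : Fin 3) (1 : ℝ)) =
        amp • EuclideanSpace.single (1 : Fin 3) (1 : ℝ) := by
      rw [← rotGen_single_zero]; rfl
    rw [h3, norm_smul, Real.norm_eq_abs, abs_of_nonneg hamp]
    simp
  have h2 : ‖EuclideanSpace.single (0 : Fin 3) (1 : ℝ)‖ = 1 := by simp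
  rw [h1, h2, mul_one] at h
  exact h

/-! ### The circle of radius `ρ` about `c` in the `(e₀, e₁)`-plane -/

/-- The displacement of the planar circle from its centre, in coordinates. [folklore] -/
theorem circleLoop_sub_centre (c : EuclideanSpace ℝ (Fin 3)) (ρ s : ℝ) :
    circleLoop c ρ (EuclideanSpace.single 0 1) (EuclideanSpace.single 1 1) s - c =
      (ρ * cos (2 * π * s)) • EuclideanSpace.single (0 : Fin 3) (1 : ℝ) +
        (ρ * sin (2 * π * s)) • EuclideanSpace.single (1 : Fin 3) (1 : ℝ) := by
  rw [circleLoop_apply]; abel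

/-- The planar circle stays at distance `|ρ|` from its centre. [folklore] -/
theorem norm_circleLoop_sub_centre (c : EuclideanSpace ℝ (Fin 3)) (ρ s : ℝ) :
    ‖circleLoop c ρ (EuclideanSpace.single 0 1) (EuclideanSpace.single 1 1) s - c‖ = |ρ| := by
  rw [circleLoop_sub_centre, ← Real.sqrt_sq_eq_abs, EuclideanSpace.norm_eq]
  congr 1
  simp [Fin.sum_univ_three]
  nlinarith [sin_sq_add_cos_sq (2 * π * s)]

/-- The speed of the planar circle is `2π|ρ|`. [folklore] -/
theorem norm_deriv_circleLoop (c : EuclideanSpace ℝ (Fin 3)) (ρ s : ℝ) :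
    ‖deriv (circleLoop c ρ (EuclideanSpace.single 0 1) (EuclideanSpace.single 1 1)) s‖ =
      2 * π * |ρ| := by
  rw [deriv_circleLoop, norm_smul, Real.norm_eq_abs, abs_of_pos Real.two_pi_pos]
  congr 1
  rw [← Real.sqrt_sq_eq_abs, EuclideanSpace.norm_eq]
  congr 1
  simp [Fin.sum_univ_three]
  nlinarith [sin_sq_add_cos_sq (2 * π * s)]

/-- **Circulation of the cut-off solid rotation around the circle of radius `ρ`** on which the
cut-off is `1`: `∮ v · dℓ = 2π amp ρ²` (the integrand is the constant `amp ρ · 2π ρ`). [cite: MajdaBertozziCUP2002, §1.6 eq. (1.57)] -/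
theorem circulation_field_circleLoop {amp a b ρ : ℝ} (c : EuclideanSpace ℝ (Fin 3))
    (hρ : 1 ≤ a - b * ρ ^ 2) :
    circulation (fun y : EuclideanSpace ℝ (Fin 3) =>
        (amp * Real.smoothTransition (a - b * ‖y - c‖ ^ 2)) • rotGen (y - c))
      (circleLoop c ρ (EuclideanSpace.single 0 1) (EuclideanSpace.single 1 1)) = 2 * π * amp * ρ ^ 2 := by
  unfold circulation
  have hint : ∀ s : ℝ, ⟪(amp * Real.smoothTransition (a - b *
      ‖circleLoop c ρ (EuclideanSpace.single 0 1) (EuclideanSpace.single 1 1) s - c‖ ^ 2)) •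
        rotGen (circleLoop c ρ (EuclideanSpace.single 0 1) (EuclideanSpace.single 1 1) s - c),
      deriv (circleLoop c ρ (EuclideanSpace.single 0 1) (EuclideanSpace.single 1 1)) s⟫ =
        2 * π * amp * ρ ^ 2 := by
    intro s
    have h1 : 1 ≤ a - b *
        ‖circleLoop c ρ (EuclideanSpace.single 0 1) (EuclideanSpace.single 1 1) s - c‖ ^ 2 := by
      rw [norm_circleLoop_sub_centre, sq_abs]; exact hρ
    rw [Real.smoothTransition.one_of_one_le h1, mul_one, circleLoop_sub_centre, deriv_circleLoop]
    simp only [rotGen_add, rotGen_smul, rotGen_single_zero, rotGen_single_one, smul_neg,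
      inner_smul_left, inner_smul_right, inner_add_left, inner_add_right, inner_neg_left,
      EuclideanSpace.inner_single_left, conj_trivial]
    simp
    linear_combination (2 * π * amp * ρ ^ 2) * sin_sq_add_cos_sq (2 * π * s)
  simp_rw [hint]
  simp

end LetterWitness

/-! ## §2 Rate identities for the reading -/

/-- The dictionary identity `A_m = N_m · Y_m` (`N^β = N · N^{β-1}`). [cite: Palasek2026ElementaryModel, §3.1] -/
theorem TowerRates.A_eq_N_mul_Y (R : TowerRates) (m : ℕ) : R.A m = R.N m * R.Y m := by
  have hN := R.N_pos m
  simp only [TowerRates.A, TowerRates.Y]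
  rw [Real.rpow_sub_one hN.ne']
  field_simp

/-- `A_m / N_m² = N_m^{β-2}` (the dictionary's core circulation scale). [cite: Palasek2026ElementaryModel, §3.1] -/
theorem TowerRates.A_div_N_sq (R : TowerRates) (m : ℕ) : R.A m / R.N m ^ 2 = R.N m ^ (R.β - 2) := by
  have hN := R.N_pos m
  simp only [TowerRates.A]
  rw [← Real.rpow_natCast (R.N m) 2, ← Real.rpow_sub hN]
  norm_num

/-- `Y_m² / N_m³ = N_m^{2β-5}` (the energy scale of one letter, Palasek's R13 ledger term).
[cite: Palasek2026ElementaryModel, §3.1] -/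
theorem TowerRates.Y_sq_div_N_cube (R : TowerRates) (m : ℕ) :
    R.Y m ^ 2 / R.N m ^ 3 = R.N m ^ (2 * R.β - 5) := by
  have hN := R.N_pos m
  simp only [TowerRates.Y]
  rw [← Real.rpow_natCast (R.N m ^ (R.β - 1)) 2, ← Real.rpow_mul hN.le, ← Real.rpow_natCast (R.N m) 3,
    ← Real.rpow_sub hN]
  norm_num
  ring_nf

/-- Along a super-lacunary scale sequence every negative power is summable:
`Σ_m N_m^{-γ} < ∞` for `γ > 0` (`N_m = N₀^{b^m} ≥ N₀^{1 + m(b-1)}`, geometric domination).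
[cite: Palasek2026ElementaryModel, §1.2] -/
theorem TowerRates.summable_N_rpow_neg (R : TowerRates) {γ : ℝ} (hγ : 0 < γ) :
    Summable (fun m : ℕ => R.N m ^ (-γ)) := by
  have hN₀ := R.one_lt_N₀
  have hb := R.one_lt_b
  -- ratio `q = N₀^{-γ(b-1)} < 1`
  set q : ℝ := R.N₀ ^ (-(γ * (R.b - 1))) with hqdef
  have hq0 : 0 ≤ q := Real.rpow_nonneg (by linarith) _
  have hq1 : q < 1 :=
    Real.rpow_lt_one_of_one_lt_of_neg hN₀ (by nlinarith)
  have hgeom : Summable (fun m : ℕ => R.N₀ ^ (-γ) * q ^ m) :=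
    (summable_geometric_of_lt_one hq0 hq1).mul_left _
  refine Summable.of_nonneg_of_le (fun m => Real.rpow_nonneg (R.N_pos m).le _) (fun m => ?_) hgeom
  -- `N_m^{-γ} = N₀^{-γ b^m} ≤ N₀^{-γ (1 + m (b-1))} = N₀^{-γ} q^m`
  have h1 : R.N m ^ (-γ) = R.N₀ ^ (-(γ * R.b ^ m)) := by
    simp only [TowerRates.N]
    rw [← Real.rpow_mul (by linarith)]; ring_nf
  have h2 : R.N₀ ^ (-γ) * q ^ m = R.N₀ ^ (-(γ * (1 + m * (R.b - 1)))) := by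
    rw [hqdef, ← Real.rpow_natCast, ← Real.rpow_mul (by linarith), ← Real.rpow_add (by linarith)]
    ring_nf
  rw [h1, h2]
  apply Real.rpow_le_rpow_of_exponent_le hN₀.le
  have h3 : 1 + (m : ℝ) * (R.b - 1) ≤ R.b ^ m := by
    have := one_add_mul_le_pow (by linarith : (-2 : ℝ) ≤ R.b - 1) m
    simpa using this
  nlinarith

end Summit.NavierStokesRegularity.FluidComputer.PalasekTowerClayBridge

end
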